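import Summits.Ventures.YMGap.RobustBall.TermPerturbation
import Summits.Ventures.YMGap.RobustBall.TorusOneLink
import Literature.MathematicalPhysics.QuantumFieldTheory.Balaban1983to89.InfiniteVolumeSufficientXIX
import HarnessLib

/-!
# Venture YMGap, track ROBUST-BALL (Y2) — crux Y2-X2-Zd, step 3: the CHART MEMBER — a finite family of
# `ℤ^d` interaction terms read on a torus through the periodic lift, as a member of the torus ball

HONEST FRAMING. WHAT THIS IS: a venture file (cell `pub-ymgap`, track Y2 ROBUST-BALL, seat ds-2); finite
bookkeeping, no probability. Given a link potential `W` on `ℤ^d` with GAUGE-INVARIANT measurable bounded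
terms depending only on their own links, and a finite family `S` of link sets (in the application: the
active listed sets through one vertex star), the CHART MEMBER `chartMember L S W …` is the torus perturbation
(`Perturbation d L N = QuasiLocalGaugePerturbation d L SU(N) 1`) whose activity on the site set `Y` is
`Σ_{X ∈ S, proj(base X) = Y} W_X ∘ torusLift L` — gauge invariance of `W_X` on `ℤ^d` is EXACTLY what the
torus carrier demands (`torusLift_gaugeTransform`). We prove: `total = Σ_{X ∈ S} W_X ∘ torusLift`
(`total_chartMember`); `HasRange R` from the `ℓ^∞` diameter of the sets (`hasRange_chartMember`); a LOAD
WITNESS transported from per-term `ℤ^d` witnesses (`chartWitness`: a term `W_X ∘ torusLift` oscillates in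
the torus link `e'` by at most `Σ_{e ∈ X, e mod L = e'} osc X e`, when `mod L` is injective on the base
sites — `isOscBound_comp_torusLift`, `isLipBound_comp_torusLift`); and the TORUS LOADS of the ball of
record (`oscLoad`, `selfLipLoad + crossLipLoad`, site incidence) bounded by the `ℤ^d` loads of `S`
(`oscLoad_chartWitness_le`, `lipLoad_chartWitness_le`), whence `chartMember … ∈ ClusterDomainFR ε₀ ε₁ R`
(`chartMember_mem_clusterDomainFR`). This is the object on which the torus robust star door
(`RobustStarDoor`) is run in the `ℤ^d` transfer. WHAT THIS IS NOT: no kernel identity (next file), no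
estimate on a measure; nothing about the continuum or the Millennium problem.

## References
* H.-O. Georgii (2011) §1.2 (periodic boundary conditions); E. Seiler, LNP 159 (1982) Ch. 2.
* The tree: `RobustBall/TermPerturbation.lean` (p1: assembled perturbations and their site-incidence loads,
  followed line by line), `Balaban1983to89/InfiniteVolumeSufficientXIX.lean` (`torusLift_gaugeTransform`).
-/

noncomputable section

open MeasureTheory Finset Function
open Literature.Probability.LatticeModels Literature.Probability.LatticeModels.DobrushinMetric
open Literature.MathematicalPhysics.QuantumLattice hiding torusNorm
open Literature.MathematicalPhysics.QuantumFieldTheory hiding ZdEdge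

namespace Summit.Ventures.YMGap.RobustBall

variable {d L N : ℕ}

/-! ### Codes and fibres -/

/-- The CODE of a `ℤ^d` link set on the torus of side `L`: its base sites reduced mod `L`. [folklore] -/
def chartCode (L : ℕ) (X : Finset (ZdEdge d)) : Finset (Site d L) := X.image fun e => Torus.proj L e.1

/-- The members of the family `S` with code `Y`. [folklore] -/
def chartFiber (L : ℕ) (S : Finset (Finset (ZdEdge d))) (Y : Finset (Site d L)) : Finset (Finset (ZdEdge d)) :=
  S.filter fun X => chartCode L X = Y

/-- Membership in a fibre. [folklore] -/
@[simp] theorem mem_chartFiber {S : Finset (Finset (ZdEdge d))} {Y : Finset (Site d L)} {X : Finset (ZdEdge d)} :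
    X ∈ chartFiber L S Y ↔ X ∈ S ∧ chartCode L X = Y := Finset.mem_filter

/-- Membership in a code. [folklore] -/
theorem mem_chartCode {X : Finset (ZdEdge d)} {x : Site d L} :
    x ∈ chartCode L X ↔ ∃ e ∈ X, Torus.proj L e.1 = x := Finset.mem_image

/-- The torus diameter of a code is at most the `ℓ^∞` diameter of the set. [folklore] -/
theorem polymerDiam_chartCode_le {X : Finset (ZdEdge d)} {R : ℕ} (hR : ∀ a ∈ X, ∀ b ∈ X, ‖a.1 - b.1‖ ≤ (R : ℝ)) :
    polymerDiam (chartCode L X) ≤ R := by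
  refine Finset.sup_le fun x hx => Finset.sup_le fun y hy => ?_
  obtain ⟨a, ha, rfl⟩ := mem_chartCode.1 hx
  obtain ⟨b, hb, rfl⟩ := mem_chartCode.1 hy
  have hsub : Torus.proj L a.1 - Torus.proj L b.1 = Torus.proj L (a.1 - b.1) := by
    funext i; simp [Torus.proj]
  rw [hsub]
  refine (torusNorm_proj_le _).trans (Finset.sup_le fun i _ => ?_)
  have h1 : ‖(a.1 - b.1) i‖ ≤ R := (norm_le_pi_norm _ i).trans (hR a ha b hb)
  rw [Int.norm_eq_abs, ← Int.cast_abs, Int.abs_eq_natAbs] at h1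
  exact_mod_cast h1

variable [NeZero L]

/-- A link of `X` projects to a link based in the code of `X`. [folklore] -/
theorem torusEdge_mem_polymerEdges_chartCode {X : Finset (ZdEdge d)} {e : ZdEdge d} (he : e ∈ X) :
    torusEdge L e ∈ polymerEdges 1 (chartCode L X) :=
  mem_polymerEdges_one.2 (mem_chartCode.2 ⟨e, he, rfl⟩)

/-! ### The chart member -/

variable (L) in
/-- **THE CHART MEMBER** of the finite family `S` of `ℤ^d` link sets for the link potential `W` (terms depending
only on their own links, gauge invariant, measurable, bounded), on the torus of side `L`: the site set `Y`
carries `Σ_{X ∈ S, code X = Y} W_X ∘ torusLift L`. A `Perturbation d L N`: local (a term reads only the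
projections of its own links, all based in its code), gauge invariant (`torusLift_gaugeTransform` + gauge
invariance of `W_X` on `ℤ^d`), measurable, bounded. [folklore] -/
def chartMember (S : Finset (Finset (ZdEdge d))) (W : Potential (ZdEdge d) (SUN N))
    (hdep : ∀ X, DependsOn (W X) (↑X : Set (ZdEdge d))) (hg : ∀ X, IsZdGaugeInvariant (W X))
    (hm : ∀ X, Measurable (W X)) (hb : ∀ X, ∃ C, ∀ U, |W X U| ≤ C) : Perturbation d L N where
  act Y V := ∑ X ∈ chartFiber L S Y, W X (torusLift L V)
  dependsOn' Y := by
    intro U V h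
    refine sum_congr rfl fun X hX => hdep X fun e he => ?_
    show U (torusEdge L e) = V (torusEdge L e)
    refine h _ (Finset.mem_coe.2 ?_)
    rw [← (mem_chartFiber.1 hX).2]
    exact torusEdge_mem_polymerEdges_chartCode (Finset.mem_coe.1 he)
  gaugeInvariant' Y g U := sum_congr rfl fun X _ => by
    rw [torusLift_gaugeTransform]
    exact hg X _ _
  measurable' Y := Finset.measurable_sum _ fun X _ => (hm X).comp (continuous_torusLift L).measurable
  bounded' Y := by
    choose C hC using hb
    exact ⟨∑ X ∈ chartFiber L S Y, C X, fun U =>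
      (abs_sum_le_sum_abs _ _).trans (sum_le_sum fun X _ => hC X _)⟩

section Member

variable {S : Finset (Finset (ZdEdge d))} {W : Potential (ZdEdge d) (SUN N)}
  {hdep : ∀ X, DependsOn (W X) (↑X : Set (ZdEdge d))} {hg : ∀ X, IsZdGaugeInvariant (W X)}
  {hm : ∀ X, Measurable (W X)} {hb : ∀ X, ∃ C, ∀ U, |W X U| ≤ C}

/-- The activities of the chart member. [folklore] -/
@[simp] theorem chartMember_act (Y : Finset (Site d L)) (V : GaugeConfig d L (SUN N)) :
    (chartMember L S W hdep hg hm hb).act Y V = ∑ X ∈ chartFiber L S Y, W X (torusLift L V) := rfl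

/-- **Total**: `(chartMember L S W).total V = Σ_{X ∈ S} W_X (torusLift L V)`. [folklore] -/
theorem total_chartMember (V : GaugeConfig d L (SUN N)) :
    (chartMember L S W hdep hg hm hb).total V = ∑ X ∈ S, W X (torusLift L V) := by
  unfold QuasiLocalGaugePerturbation.total
  simp only [chartMember_act, chartFiber]
  exact sum_fiberwise_of_maps_to (fun X _ => mem_polymers_one (chartCode L X)) _

/-- **Range**: sets of `ℓ^∞` diameter `≤ R` give `HasRange R`. [folklore] -/
theorem hasRange_chartMember {R : ℕ} (hR : ∀ X ∈ S, ∀ a ∈ X, ∀ b ∈ X, ‖a.1 - b.1‖ ≤ (R : ℝ)) :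
    HasRange R (chartMember L S W hdep hg hm hb) := by
  intro Y hY
  funext U
  simp only [chartMember_act, Pi.zero_apply]
  refine sum_eq_zero fun X hX => ?_
  obtain ⟨hXS, hXY⟩ := mem_chartFiber.1 hX
  have h1 := polymerDiam_chartCode_le (L := L) (hR X hXS)
  rw [hXY] at h1
  exact absurd h1 (not_le.2 hY)

end Member

/-! ### Transport of one-link witnesses through the periodic lift -/

omit [NeZero L] in
/-- The fibre of `e'` in a link set on which `torusEdge L` is injective: a singleton or empty. [folklore] -/
theorem filter_torusEdge_eq_singleton {X : Finset (ZdEdge d)} (hinj : Set.InjOn (torusEdge L) (X : Set (ZdEdge d)))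
    {e₀ : ZdEdge d} (he₀ : e₀ ∈ X) {e' : Edge d L} (he₀' : torusEdge L e₀ = e') :
    X.filter (fun e => torusEdge L e = e') = {e₀} := by
  ext e
  simp only [mem_filter, mem_singleton]
  constructor
  · rintro ⟨he, hee⟩
    exact hinj (Finset.mem_coe.2 he) (Finset.mem_coe.2 he₀) (hee.trans he₀'.symm)
  · rintro rfl
    exact ⟨he₀, he₀'⟩

omit [NeZero L] in
/-- **A `ℤ^d` term read through the periodic lift oscillates in the torus link `e'` by at most the sum of its
`ℤ^d` oscillations over the links of its set projecting to `e'`** (at most one when `torusEdge L` is injective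
on the set; the lift changes at every preimage of `e'`, but the term reads only its own links). [folklore] -/
theorem isOscBound_comp_torusLift {X : Finset (ZdEdge d)} {F : LGConfig d (SUN N) → ℝ}
    (hdep : DependsOn F (↑X : Set (ZdEdge d))) {δ : ZdEdge d → ℝ} (hδ : Dobrushin.IsOscBound F δ)
    (hinj : Set.InjOn (torusEdge L) (X : Set (ZdEdge d))) :
    Dobrushin.IsOscBound (fun V : GaugeConfig d L (SUN N) => F (torusLift L V))
      fun e' => ∑ e ∈ X.filter (fun e => torusEdge L e = e'), δ e := by
  classical
  refine ⟨fun e' => sum_nonneg fun e _ => hδ.nonneg e, fun e' V V' hVV' => ?_⟩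
  by_cases h : ∃ e₀ ∈ X, torusEdge L e₀ = e'
  · obtain ⟨e₀, he₀, he₀'⟩ := h
    rw [filter_torusEdge_eq_singleton hinj he₀ he₀', sum_singleton]
    have h1 : F (torusLift L V') = F (Function.update (torusLift L V) e₀ (V' e')) := by
      refine hdep fun e he => ?_
      by_cases hee : e = e₀
      · subst hee; simp [torusLift, he₀']
      · have hne : torusEdge L e ≠ e' := fun h' =>
          hee (hinj he (Finset.mem_coe.2 he₀) (h'.trans he₀'.symm))
        rw [Function.update_of_ne hee]
        simp only [torusLift, Function.comp_apply]
        exact (hVV' _ hne).symm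
    rw [h1]
    exact hδ.le e₀ _ _ fun z hz => (Function.update_of_ne hz _ _).symm
  · have h1 : F (torusLift L V) = F (torusLift L V') := hdep fun e he =>
      hVV' _ fun h' => h ⟨e, Finset.mem_coe.1 he, h'⟩
    rw [h1, sub_self, abs_zero]
    exact sum_nonneg fun e _ => hδ.nonneg e

omit [NeZero L] in
/-- The Lipschitz version of `isOscBound_comp_torusLift`, for any nonnegative link weight `r`. [folklore] -/
theorem isLipBound_comp_torusLift {r : SUN N → SUN N → ℝ} (hr : ∀ a b, 0 ≤ r a b) {X : Finset (ZdEdge d)}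
    {F : LGConfig d (SUN N) → ℝ} (hdep : DependsOn F (↑X : Set (ZdEdge d))) {δ : ZdEdge d → ℝ}
    (hδ : IsLipBound r F δ) (hinj : Set.InjOn (torusEdge L) (X : Set (ZdEdge d))) :
    IsLipBound r (fun V : GaugeConfig d L (SUN N) => F (torusLift L V))
      fun e' => ∑ e ∈ X.filter (fun e => torusEdge L e = e'), δ e := by
  classical
  refine ⟨fun e' => sum_nonneg fun e _ => hδ.nonneg e, fun e' V V' hVV' => ?_⟩
  by_cases h : ∃ e₀ ∈ X, torusEdge L e₀ = e'
  · obtain ⟨e₀, he₀, he₀'⟩ := h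
    rw [filter_torusEdge_eq_singleton hinj he₀ he₀', sum_singleton]
    have h1 : F (torusLift L V') = F (Function.update (torusLift L V) e₀ (V' e')) := by
      refine hdep fun e he => ?_
      by_cases hee : e = e₀
      · subst hee; simp [torusLift, he₀']
      · have hne : torusEdge L e ≠ e' := fun h' =>
          hee (hinj he (Finset.mem_coe.2 he₀) (h'.trans he₀'.symm))
        rw [Function.update_of_ne hee]
        simp only [torusLift, Function.comp_apply]
        exact (hVV' _ hne).symm
    rw [h1]
    have h2 := hδ.le e₀ (torusLift L V) (Function.update (torusLift L V) e₀ (V' e'))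
      fun z hz => (Function.update_of_ne hz _ _).symm
    simpa [torusLift, he₀'] using h2
  · have h1 : F (torusLift L V) = F (torusLift L V') := hdep fun e he =>
      hVV' _ fun h' => h ⟨e, Finset.mem_coe.1 he, h'⟩
    rw [h1, sub_self, abs_zero]
    exact mul_nonneg (sum_nonneg fun e _ => hδ.nonneg e) (hr _ _)

/-! ### The transported load witness and the torus loads -/

section Loads

variable {S : Finset (Finset (ZdEdge d))} {W : Potential (ZdEdge d) (SUN N)}
  {hdep : ∀ X, DependsOn (W X) (↑X : Set (ZdEdge d))} {hg : ∀ X, IsZdGaugeInvariant (W X)}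
  {hm : ∀ X, Measurable (W X)} {hb : ∀ X, ∃ C, ∀ U, |W X U| ≤ C}
  {B : Finset (Literature.Probability.LatticeModels.Site d)}

omit [NeZero L] in
/-- Injectivity of the reduction on the base sites `B` of the family gives injectivity of `torusEdge L` on
every member. [folklore] -/
theorem injOn_torusEdge_of_base (hinj : Set.InjOn (Torus.proj L) (B : Set (Literature.Probability.LatticeModels.Site d)))
    (hB : ∀ X ∈ S, ∀ e ∈ X, e.1 ∈ B)
    {X : Finset (ZdEdge d)} (hX : X ∈ S) : Set.InjOn (torusEdge L) (X : Set (ZdEdge d)) :=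
  injOn_torusEdge (hinj.mono fun v hv => by
    obtain ⟨e, he, rfl⟩ := Finset.mem_image.1 (Finset.mem_coe.1 hv)
    exact Finset.mem_coe.2 (hB X hX e he))

/-- **The transported LOAD WITNESS of the chart member**: per-code sums of the transported one-link witnesses
of its terms. [folklore] -/
def chartWitness (hinj : Set.InjOn (Torus.proj L) (B : Set (Literature.Probability.LatticeModels.Site d)))
    (hB : ∀ X ∈ S, ∀ e ∈ X, e.1 ∈ B)
    {osc lip : Finset (ZdEdge d) → ZdEdge d → ℝ} (hosc : ∀ X, Dobrushin.IsOscBound (W X) (osc X))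
    (hlip : ∀ X, IsLipBound suFrobDist (W X) (lip X)) : LoadWitness (chartMember L S W hdep hg hm hb) where
  osc Y e' := ∑ X ∈ chartFiber L S Y, ∑ e ∈ X.filter (fun e => torusEdge L e = e'), osc X e
  lip Y y' := ∑ X ∈ chartFiber L S Y, ∑ y ∈ X.filter (fun y => torusEdge L y = y'), lip X y
  osc_spec _ := isOscBound_sum _ fun X hX =>
    isOscBound_comp_torusLift (hdep X) (hosc X) (injOn_torusEdge_of_base hinj hB (mem_chartFiber.1 hX).1)
  lip_spec _ := isLipBound_sum _ fun X hX =>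
    isLipBound_comp_torusLift suFrobDist_nonneg (hdep X) (hlip X)
      (injOn_torusEdge_of_base hinj hB (mem_chartFiber.1 hX).1)

variable {hinj : Set.InjOn (Torus.proj L) (B : Set (Literature.Probability.LatticeModels.Site d))}
  {hB : ∀ X ∈ S, ∀ e ∈ X, e.1 ∈ B}
  {osc lip : Finset (ZdEdge d) → ZdEdge d → ℝ} {hosc : ∀ X, Dobrushin.IsOscBound (W X) (osc X)}
  {hlip : ∀ X, IsLipBound suFrobDist (W X) (lip X)}

omit [NeZero L] in
/-- A preimage base site of a torus site is unique in `B`; a link of the family projecting to `e'` is then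
THE link `(v₀, e'.2)`. [folklore] -/
theorem eq_of_torusEdge_eq (hinj : Set.InjOn (Torus.proj L) (B : Set (Literature.Probability.LatticeModels.Site d)))
    (hB : ∀ X ∈ S, ∀ e ∈ X, e.1 ∈ B)
    {v₀ : Literature.Probability.LatticeModels.Site d} (hv₀ : v₀ ∈ B) {e' : Edge d L}
    (hv₀' : Torus.proj L v₀ = e'.1)
    {X : Finset (ZdEdge d)} (hX : X ∈ S) {e : ZdEdge d} (he : e ∈ X) (hee : torusEdge L e = e') :
    e = (v₀, e'.2) := by
  have h1 : Torus.proj L e.1 = Torus.proj L v₀ := by rw [hv₀', ← hee]; rfl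
  have h2 : e.1 = v₀ := hinj (Finset.mem_coe.2 (hB X hX e he)) (Finset.mem_coe.2 hv₀) h1
  refine Prod.ext h2 ?_
  rw [← hee]; rfl

/-- **The torus OSCILLATION LOAD of the chart member is bounded by the `ℤ^d` oscillation load of the family**:
`oscLoad 0 e' ≤ ε₀` whenever `Σ_{X ∈ S, e ∈ X} osc X e ≤ ε₀` for every `ℤ^d` link `e` (and `0 ≤ ε₀`). [folklore] -/
theorem oscLoad_chartWitness_le {ε₀ : ℝ} (hε₀ : 0 ≤ ε₀)
    (h₀ : ∀ e : ZdEdge d, ∑ X ∈ S.filter (fun X => e ∈ X), osc X e ≤ ε₀) (e' : Edge d L) :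
    (chartWitness (hdep := hdep) (hg := hg) (hm := hm) (hb := hb) hinj hB hosc hlip).oscLoad 0 e' ≤ ε₀ := by
  classical
  have hnn : ∀ X, 0 ≤ ∑ e ∈ X.filter (fun e => torusEdge L e = e'), osc X e :=
    fun X => sum_nonneg fun e _ => (hosc X).nonneg e
  calc (chartWitness (hdep := hdep) (hg := hg) (hm := hm) (hb := hb) hinj hB hosc hlip).oscLoad 0 e'
      = ∑ Y ∈ polymersThroughEdge e', ∑ X ∈ chartFiber L S Y,
          ∑ e ∈ X.filter (fun e => torusEdge L e = e'), osc X e := by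
        simp [LoadWitness.oscLoad, chartWitness]
    _ ≤ ∑ Y ∈ polymers (d := d) (L := L) 1, ∑ X ∈ chartFiber L S Y,
          ∑ e ∈ X.filter (fun e => torusEdge L e = e'), osc X e :=
        sum_le_sum_of_subset_of_nonneg (Finset.filter_subset _ _) fun Y _ _ => sum_nonneg fun X _ => hnn X
    _ = ∑ X ∈ S, ∑ e ∈ X.filter (fun e => torusEdge L e = e'), osc X e := by
        simp only [chartFiber]
        exact sum_fiberwise_of_maps_to (fun X _ => mem_polymers_one (chartCode L X)) _
    _ ≤ ε₀ := by
        by_cases h : ∃ v₀ ∈ B, Torus.proj L v₀ = e'.1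
        · obtain ⟨v₀, hv₀, hv₀'⟩ := h
          have hX : ∀ X ∈ S, ∑ e ∈ X.filter (fun e => torusEdge L e = e'), osc X e =
              if ((v₀, e'.2) : ZdEdge d) ∈ X then osc X (v₀, e'.2) else 0 := by
            intro X hX
            split_ifs with hmem
            · rw [filter_torusEdge_eq_singleton (injOn_torusEdge_of_base hinj hB hX) hmem
                (Prod.ext hv₀' rfl), sum_singleton]
            · refine sum_eq_zero fun e he => ?_
              obtain ⟨heX, hee⟩ := mem_filter.1 he
              exact absurd (eq_of_torusEdge_eq hinj hB hv₀ hv₀' hX heX hee ▸ heX) hmem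
          rw [sum_congr rfl hX, ← sum_filter]
          exact h₀ _
        · have hX : ∀ X ∈ S, ∑ e ∈ X.filter (fun e => torusEdge L e = e'), osc X e = 0 := by
            intro X hX
            refine sum_eq_zero fun e he => ?_
            obtain ⟨heX, hee⟩ := mem_filter.1 he
            exact absurd ⟨e.1, hB X hX e heX, by rw [← hee]; rfl⟩ h
          rw [sum_congr rfl hX, sum_const_zero]
          exact hε₀

/-- **The torus LIPSCHITZ LOAD (self + cross, site incidence) of the chart member is bounded by the `ℤ^d`
site-incidence Lipschitz load of the family**: `selfLipLoad 0 e' + crossLipLoad 0 e' ≤ ε₁` whenever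
`Σ_{X ∈ S with a link based at v} Σ_{y ∈ X} lip X y ≤ ε₁` for every `ℤ^d` site `v` (and `0 ≤ ε₁`). [folklore] -/
theorem lipLoad_chartWitness_le {ε₁ : ℝ} (hε₁ : 0 ≤ ε₁)
    (h₁ : ∀ v : Literature.Probability.LatticeModels.Site d,
      ∑ X ∈ S.filter (fun X => v ∈ X.image Prod.fst), ∑ y ∈ X, lip X y ≤ ε₁)
    (e' : Edge d L) :
    (chartWitness (hdep := hdep) (hg := hg) (hm := hm) (hb := hb) hinj hB hosc hlip).selfLipLoad 0 e' +
      (chartWitness (hdep := hdep) (hg := hg) (hm := hm) (hb := hb) hinj hB hosc hlip).crossLipLoad 0 e' ≤ ε₁ := by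
  classical
  set w := chartWitness (hdep := hdep) (hg := hg) (hm := hm) (hb := hb) hinj hB hosc hlip with hw
  have hlipY : ∀ Y y', 0 ≤ w.lip Y y' := fun Y y' => (w.lip_spec Y).nonneg y'
  -- self + cross ≤ Σ_{y'} Σ_{Y ∋ e'.1} lip Y y'
  have hself : w.selfLipLoad 0 e' = ∑ Y ∈ polymersThroughEdge e', w.lip Y e' := by
    simp [LoadWitness.selfLipLoad]
  have hcross : w.crossLipLoad 0 e' ≤ ∑ y' ∈ univ.erase e', ∑ Y ∈ polymersThroughEdge e', w.lip Y y' := by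
    simp only [LoadWitness.crossLipLoad, LoadWitness.crossLip, zero_mul, Real.exp_zero, one_mul]
    exact sum_le_sum fun y' _ =>
      sum_le_sum_of_subset_of_nonneg (Finset.filter_subset _ _) fun Y _ _ => hlipY Y y'
  have hstep : w.selfLipLoad 0 e' + w.crossLipLoad 0 e' ≤
      ∑ Y ∈ polymersThroughEdge e', ∑ y' : Edge d L, w.lip Y y' := by
    rw [sum_comm, ← Finset.add_sum_erase _ _ (mem_univ e'), hself]
    exact add_le_add le_rfl hcross
  refine hstep.trans ?_
  -- Σ_{y'} lip Y y' = Σ_{X ∈ fibre Y} Σ_{y ∈ X} lip X y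
  have hY : ∀ Y, ∑ y' : Edge d L, w.lip Y y' = ∑ X ∈ chartFiber L S Y, ∑ y ∈ X, lip X y := by
    intro Y
    simp only [hw, chartWitness]
    rw [sum_comm]
    exact sum_congr rfl fun X _ => sum_fiberwise X (torusEdge L) (lip X)
  simp_rw [hY]
  simp only [chartFiber]
  rw [sum_fiberwise_eq_sum_filter]
  by_cases h : ∃ v₀ ∈ B, Torus.proj L v₀ = e'.1
  · obtain ⟨v₀, hv₀, hv₀'⟩ := h
    have hfil : S.filter (fun X => chartCode L X ∈ polymersThroughEdge e') =
        S.filter (fun X => v₀ ∈ X.image Prod.fst) := by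
      refine Finset.filter_congr fun X hX => ?_
      rw [mem_polymersThroughEdge_iff, mem_chartCode, Finset.mem_image]
      constructor
      · rintro ⟨e, he, hee⟩
        refine ⟨e, he, hinj (Finset.mem_coe.2 (hB X hX e he)) (Finset.mem_coe.2 hv₀) ?_⟩
        rw [hee, hv₀']
      · rintro ⟨e, he, hee⟩
        exact ⟨e, he, by rw [hee, hv₀']⟩
    rw [hfil]
    exact h₁ v₀
  · have hfil : S.filter (fun X => chartCode L X ∈ polymersThroughEdge e') = ∅ := by
      refine Finset.filter_eq_empty_iff.2 fun X hX hmem => ?_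
      rw [mem_polymersThroughEdge_iff, mem_chartCode] at hmem
      obtain ⟨e, he, hee⟩ := hmem
      exact h ⟨e.1, hB X hX e he, hee⟩
    rw [hfil, sum_empty]
    exact hε₁

end Loads

/-- **THE CHART MEMBER LIES IN THE TORUS BALL OF RECORD** `ClusterDomainFR ε₀ ε₁ R`, given: `ℓ^∞` diameter
`≤ R` of every set of the family, injectivity of `mod L` on the base sites of the family, per-term `ℤ^d`
witnesses, the `ℤ^d` oscillation load `≤ ε₀` at every link and the `ℤ^d` site-incidence Lipschitz load `≤ ε₁`
at every site (both over the family `S`). [folklore] -/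
theorem chartMember_mem_clusterDomainFR {S : Finset (Finset (ZdEdge d))} {W : Potential (ZdEdge d) (SUN N)}
    {hdep : ∀ X, DependsOn (W X) (↑X : Set (ZdEdge d))} {hg : ∀ X, IsZdGaugeInvariant (W X)}
    {hm : ∀ X, Measurable (W X)} {hb : ∀ X, ∃ C, ∀ U, |W X U| ≤ C}
    {B : Finset (Literature.Probability.LatticeModels.Site d)}
    (hinj : Set.InjOn (Torus.proj L) (B : Set (Literature.Probability.LatticeModels.Site d)))
    (hB : ∀ X ∈ S, ∀ e ∈ X, e.1 ∈ B)
    {osc lip : Finset (ZdEdge d) → ZdEdge d → ℝ} (hosc : ∀ X, Dobrushin.IsOscBound (W X) (osc X))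
    (hlip : ∀ X, IsLipBound suFrobDist (W X) (lip X))
    {R : ℕ} (hR : ∀ X ∈ S, ∀ a ∈ X, ∀ b ∈ X, ‖a.1 - b.1‖ ≤ (R : ℝ))
    {ε₀ ε₁ : ℝ} (hε₀ : 0 ≤ ε₀) (hε₁ : 0 ≤ ε₁)
    (h₀ : ∀ e : ZdEdge d, ∑ X ∈ S.filter (fun X => e ∈ X), osc X e ≤ ε₀)
    (h₁ : ∀ v : Literature.Probability.LatticeModels.Site d,
      ∑ X ∈ S.filter (fun X => v ∈ X.image Prod.fst), ∑ y ∈ X, lip X y ≤ ε₁) :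
    chartMember L S W hdep hg hm hb ∈ ClusterDomainFR ε₀ ε₁ R :=
  ⟨hasRange_chartMember hR, chartWitness hinj hB hosc hlip, fun e' => oscLoad_chartWitness_le hε₀ h₀ e',
    fun e' => lipLoad_chartWitness_le hε₁ h₁ e'⟩

end Summit.Ventures.YMGap.RobustBall

end
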